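import Mathlib

/-!
# The difference pencil of THREE sets: the ordered half over every field, and the cyclic tournament

Helper file for crux `stmt-CriticalPhenomena-4575` (`NoHeavyLowerTail`, route `PercNearOneGluingNoHeavy`),
new-inequality factory seat `prim-ineq-gen-3` (gen 26).  Everything here is PROVED; no definitions.

Pencil row of a finite set `C`: `E ↦ [E ⊆ C] + t [E ∩ C = ∅]`.  CONJECTURE ORD (gen 25, memo
`run/shared/lean/prim/prim-ineq-gen-3/CONJECTURE-ORD.md`): for sets `A₁, …, Aₘ` in an ADMISSIBLE order
(`i < j ⟹ Aᵢ ⊄ Aⱼ`) the rows restricted to the ordered half `{∅} ∪ {Aᵢ \ Aⱼ : i < j}` are independent for every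
complex `t ≠ ±1` (verified by exact computation for all families of at most five sets; false over `ZMod 7` for four sets,
`…OrderedDifferencesOrdHalfF7`).  This file PROVES the case `m = 3` over EVERY field:

* `three_rows_transitive_aux`, `dep_eq_zero_three_sets_ordered` — for `A₁ ⊄ A₂`, `A₁ ⊄ A₃`, `A₂ ⊄ A₃` and any `t`
  with `t + 1 ≠ 0`, `t - 1 ≠ 0` (in any field), every dependency of the three rows on the columns
  `∅, A₁ \ A₂, A₁ \ A₃, A₂ \ A₃` vanishes.  [The third row meets the column `Aᵢ \ Aⱼ` in an entry `x ∈ {0, 1, t}`; for each of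
  the 27 patterns some `3 × 3` minor is `±(t+1)^a (t-1)^b` — except the generic pattern, where `1 + t³` and `t² + t` combine
  to `t + 1` — so no realizability argument is needed.]
* `three_rows_cyclic_aux`, `dep_eq_zero_three_sets_cyclic` — for the CYCLIC orientation (columns `∅, A₁ \ A₂, A₂ \ A₃,
  A₃ \ A₁`, legal when `A₁ ⊄ A₂`, `A₂ ⊄ A₃`, `A₃ ⊄ A₁`) the same holds provided additionally `t² - t + 1 ≠ 0`: the primitive
  sixth roots of unity are genuine eigenvalues of cyclic triples in general position (cycle minor `1 + t³`).  Gen 26 found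
  that arbitrary tournaments keep cyclotomic spectra for all families of at most four sets but acquire golden-ratio
  eigenvalues from five sets on (`…OrderedDifferencesCyclicTournament`): acyclicity is essential in CONJECTURE ORD.
(prim-ineq-gen-3 gen 26, 2026-08-25.)
-/

namespace Summit.CriticalPhenomena.PercolationContinuityZ3.Theorems

namespace OrderedDifferences

open Finset

/-- Cancelling a common non-zero factor from three products. -/
theorem cancel3 {K : Type*} [Field K] {F c₁ c₂ c₃ : K} (hF : F ≠ 0) (k1 : F * c₁ = 0) (k2 : F * c₂ = 0)
    (k3 : F * c₃ = 0) : c₁ = 0 ∧ c₂ = 0 ∧ c₃ = 0 :=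
  ⟨(mul_eq_zero.mp k1).resolve_left hF, (mul_eq_zero.mp k2).resolve_left hF, (mul_eq_zero.mp k3).resolve_left hF⟩

/-- The abstract `3 × 4` system behind three sets in an admissible order (transitive tournament): if
`(1+t)(c₁+c₂+c₃) = 0`, `c₁ + t c₂ + x₁ c₃ = 0`, `c₁ + x₂ c₂ + t c₃ = 0`, `x₃ c₁ + c₂ + t c₃ = 0` with
`x₁, x₂, x₃ ∈ {0, 1, t}` and `t ≠ ±1`, then `c = 0` (all 27 patterns; in 26 of them a single `3 × 3` minor is
`±(t+1)^a (t-1)^b`, in the generic pattern `x = 0` the two minors `1 + t³` and `t² + t` combine to `t + 1`). -/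
theorem three_rows_transitive_aux {K : Type*} [Field K] (t c₁ c₂ c₃ x₁ x₂ x₃ : K)
    (h1 : t + 1 ≠ 0) (h2 : t - 1 ≠ 0)
    (hx₁ : x₁ = 0 ∨ x₁ = 1 ∨ x₁ = t) (hx₂ : x₂ = 0 ∨ x₂ = 1 ∨ x₂ = t) (hx₃ : x₃ = 0 ∨ x₃ = 1 ∨ x₃ = t)
    (e0 : (1 + t) * c₁ + (1 + t) * c₂ + (1 + t) * c₃ = 0)
    (e1 : c₁ + t * c₂ + x₁ * c₃ = 0) (e2 : c₁ + x₂ * c₂ + t * c₃ = 0) (e3 : x₃ * c₁ + c₂ + t * c₃ = 0) :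
    c₁ = 0 ∧ c₂ = 0 ∧ c₃ = 0 := by
  rcases hx₁ with ha | ha | ha <;> rcases hx₂ with hb | hb | hb <;> rcases hx₃ with hc | hc | hc <;>
    rw [ha] at e1 <;> rw [hb] at e2 <;> rw [hc] at e3
  · -- (x₁, x₂, x₃) = (0, 0, 0): F = (t + 1)
    exact cancel3 h1 (by linear_combination (t^2) * e0 + (1 + t - 2 * t^2) * e1 + (t^2 - t^3) * e2 + (-t - 2 * t^2 + t^3) * e3)
      (by linear_combination (-t) * e0 + (2 * t) * e1 + (-t + t^2) * e2 + (1 + 2 * t - t^2) * e3)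
      (by linear_combination (1) * e0 + (-2) * e1 + (1 - t) * e2 + (-1 + t) * e3)
  · -- (x₁, x₂, x₃) = (0, 0, 1): F = (t + 1) * (t - 1)
    exact cancel3 (mul_ne_zero h1 h2) (by linear_combination (t) * e0 + (-1 + t^2) * e2 + (-t - t^2) * e3)
      (by linear_combination (1 - t^2) * e2 + (-1 + t^2) * e3)
      (by linear_combination (-1) * e0 + (1 + t) * e3)
  · -- (x₁, x₂, x₃) = (0, 0, t): F = (t + 1) * (t - 1)
    exact cancel3 (mul_ne_zero h1 h2) (by linear_combination (-t^2) * e0 + (-1 + t^2) * e1 + (t + t^2) * e3)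
      (by linear_combination (t) * e0 + (-1 - t) * e3)
      (by linear_combination (-1 + t^2) * e0 + (1 - t^2) * e1 + (1 - t^2) * e3)
  · -- (x₁, x₂, x₃) = (0, 1, 0): F = (t + 1) * (t - 1)
    exact cancel3 (mul_ne_zero h1 h2) (by linear_combination (-1 + t^2) * e2 + (1 - t^2) * e3)
      (by linear_combination (t) * e0 + (-t - t^2) * e2 + (-1 + t^2) * e3)
      (by linear_combination (-1) * e0 + (1 + t) * e2)
  · -- (x₁, x₂, x₃) = (0, 1, 1): F = (t + 1) * (t - 1) ^ 2
    exact cancel3 (mul_ne_zero h1 (pow_ne_zero 2 h2)) (by linear_combination (t^2) * e0 + (1 - t^2) * e1 + (-t - t^2) * e2)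
      (by linear_combination (-t) * e0 + (-1 + t^2) * e1 + (1 + t) * e2)
      (by linear_combination (1 - t) * e0 + (-1 + t^2) * e2)
  · -- (x₁, x₂, x₃) = (0, 1, t): F = (t + 1) * (t - 1)
    exact cancel3 (mul_ne_zero h1 h2) (by linear_combination (-t^2) * e0 + (-1 + t^2) * e1 + (t + t^2) * e3)
      (by linear_combination (t) * e0 + (-1 - t) * e3)
      (by linear_combination (-1 + t^2) * e0 + (1 - t^2) * e1 + (1 - t^2) * e3)
  · -- (x₁, x₂, x₃) = (0, t, 0): F = (t + 1) * (t - 1) ^ 2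
    exact cancel3 (mul_ne_zero h1 (pow_ne_zero 2 h2)) (by linear_combination (-t + t^2) * e0 + (1 - t^2) * e2)
      (by linear_combination (-t) * e0 + (t + t^2) * e2 + (1 - t^2) * e3)
      (by linear_combination (1) * e0 + (-1 - t) * e2 + (-1 + t^2) * e3)
  · -- (x₁, x₂, x₃) = (0, t, 1): F = (t + 1) * (t - 1) ^ 2
    exact cancel3 (mul_ne_zero h1 (pow_ne_zero 2 h2)) (by linear_combination (t^2) * e0 + (1 - t^2) * e1 + (-t - t^2) * e3)
      (by linear_combination (-t) * e0 + (-1 + t^2) * e1 + (1 + t) * e3)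
      (by linear_combination (1 - t) * e0 + (-1 + t^2) * e3)
  · -- (x₁, x₂, x₃) = (0, t, t): F = (t + 1) * (t - 1)
    exact cancel3 (mul_ne_zero h1 h2) (by linear_combination (-t^2) * e0 + (-1 + t^2) * e1 + (t + t^2) * e3)
      (by linear_combination (t) * e0 + (-1 - t) * e3)
      (by linear_combination (-1 + t^2) * e0 + (1 - t^2) * e1 + (1 - t^2) * e3)
  · -- (x₁, x₂, x₃) = (1, 0, 0): F = (t + 1) * (t - 1) ^ 2
    exact cancel3 (mul_ne_zero h1 (pow_ne_zero 2 h2)) (by linear_combination (t^2) * e0 + (-t - t^2) * e1 + (1 - t^2) * e2)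
      (by linear_combination (1 - t) * e0 + (-1 + t^2) * e1)
      (by linear_combination (-t) * e0 + (1 + t) * e1 + (-1 + t^2) * e2)
  · -- (x₁, x₂, x₃) = (1, 0, 1): F = (t - 1)
    exact cancel3 h2 (by linear_combination (t) * e1 + (-1 + t^2) * e2 + (-t^2) * e3)
      (by linear_combination (1 - t) * e2 + (-1 + t) * e3)
      (by linear_combination (-1) * e1 + (1 - t) * e2 + (t) * e3)
  · -- (x₁, x₂, x₃) = (1, 0, t): F = (t + 1) * (t - 1) ^ 2
    exact cancel3 (mul_ne_zero h1 (pow_ne_zero 2 h2)) (by linear_combination (t^2) * e0 + (-t - t^2) * e1 + (1 - t^2) * e2)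
      (by linear_combination (1 - t) * e0 + (-1 + t^2) * e1)
      (by linear_combination (-t) * e0 + (1 + t) * e1 + (-1 + t^2) * e2)
  · -- (x₁, x₂, x₃) = (1, 1, 0): F = (t + 1) * (t - 1)
    exact cancel3 (mul_ne_zero h1 h2) (by linear_combination (-1 + t^2) * e2 + (1 - t^2) * e3)
      (by linear_combination (t) * e0 + (-t - t^2) * e2 + (-1 + t^2) * e3)
      (by linear_combination (-1) * e0 + (1 + t) * e2)
  · -- (x₁, x₂, x₃) = (1, 1, 1): F = (t + 1) * (t - 1) ^ 2
    exact cancel3 (mul_ne_zero h1 (pow_ne_zero 2 h2)) (by linear_combination (-1 + t^2) * e0 + (1 - t^2) * e1 + (1 - t^2) * e2)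
      (by linear_combination (1 - t) * e0 + (-1 + t^2) * e1)
      (by linear_combination (1 - t) * e0 + (-1 + t^2) * e2)
  · -- (x₁, x₂, x₃) = (1, 1, t): F = (t + 1) * (t - 1) ^ 2
    exact cancel3 (mul_ne_zero h1 (pow_ne_zero 2 h2)) (by linear_combination (-1 + t^2) * e0 + (1 - t^2) * e1 + (1 - t^2) * e2)
      (by linear_combination (1 - t) * e0 + (-1 + t^2) * e1)
      (by linear_combination (1 - t) * e0 + (-1 + t^2) * e2)
  · -- (x₁, x₂, x₃) = (1, t, 0): F = (t - 1)
    exact cancel3 h2 (by linear_combination (t - t^2) * e1 + (-1 + t^2) * e2 + (t - t^2) * e3)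
      (by linear_combination (t) * e1 + (-t) * e2 + (-1 + t) * e3)
      (by linear_combination (-1) * e1 + (1) * e2)
  · -- (x₁, x₂, x₃) = (1, t, 1): F = (t - 1) ^ 2
    exact cancel3 (pow_ne_zero 2 h2) (by linear_combination (-t + t^2) * e1 + (1 - t^2) * e2 + (-t + t^2) * e3)
      (by linear_combination (-1 + t) * e2 + (1 - t) * e3)
      (by linear_combination (1 - t) * e1 + (-1 + t) * e2)
  · -- (x₁, x₂, x₃) = (1, t, t): F = (t + 1) * (t - 1) ^ 2
    exact cancel3 (mul_ne_zero h1 (pow_ne_zero 2 h2)) (by linear_combination (-t + t^2) * e0 + (1 - t^2) * e2)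
      (by linear_combination (1 - t) * e0 + (-1 + t^2) * e1)
      (by linear_combination (1 - t^2) * e1 + (-1 + t^2) * e2)
  · -- (x₁, x₂, x₃) = (t, 0, 0): F = (t + 1) * (t - 1) ^ 2
    exact cancel3 (mul_ne_zero h1 (pow_ne_zero 2 h2)) (by linear_combination (-t + t^2) * e0 + (1 - t^2) * e1)
      (by linear_combination (-t) * e0 + (t + t^2) * e1 + (1 - t^2) * e3)
      (by linear_combination (1) * e0 + (-1 - t) * e1 + (-1 + t^2) * e3)
  · -- (x₁, x₂, x₃) = (t, 0, 1): F = (t + 1) * (t - 1)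
    exact cancel3 (mul_ne_zero h1 h2) (by linear_combination (t) * e0 + (-1 + t^2) * e2 + (-t - t^2) * e3)
      (by linear_combination (1 - t^2) * e2 + (-1 + t^2) * e3)
      (by linear_combination (-1) * e0 + (1 + t) * e3)
  · -- (x₁, x₂, x₃) = (t, 0, t): F = (t + 1) * (t - 1) ^ 2
    exact cancel3 (mul_ne_zero h1 (pow_ne_zero 2 h2)) (by linear_combination (-t + t^2) * e0 + (1 - t^2) * e1)
      (by linear_combination (-t + t^2) * e0 + (1 - t^2) * e3)
      (by linear_combination (1 - t^2) * e0 + (-1 + t^2) * e1 + (-1 + t^2) * e3)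
  · -- (x₁, x₂, x₃) = (t, 1, 0): F = (t + 1) * (t - 1)
    exact cancel3 (mul_ne_zero h1 h2) (by linear_combination (-1 + t^2) * e2 + (1 - t^2) * e3)
      (by linear_combination (t) * e0 + (-t - t^2) * e2 + (-1 + t^2) * e3)
      (by linear_combination (-1) * e0 + (1 + t) * e2)
  · -- (x₁, x₂, x₃) = (t, 1, 1): F = (t + 1) * (t - 1) ^ 2
    exact cancel3 (mul_ne_zero h1 (pow_ne_zero 2 h2)) (by linear_combination (-t + t^2) * e0 + (1 - t^2) * e1)
      (by linear_combination (-1 + t^2) * e1 + (1 - t^2) * e2)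
      (by linear_combination (1 - t) * e0 + (-1 + t^2) * e2)
  · -- (x₁, x₂, x₃) = (t, 1, t): F = (t + 1) * (t - 1) ^ 2
    exact cancel3 (mul_ne_zero h1 (pow_ne_zero 2 h2)) (by linear_combination (-t + t^2) * e0 + (1 - t^2) * e1)
      (by linear_combination (-1 + t^2) * e1 + (1 - t^2) * e2)
      (by linear_combination (1 - t) * e0 + (-1 + t^2) * e2)
  · -- (x₁, x₂, x₃) = (t, t, 0): F = (t + 1) * (t - 1) ^ 2
    exact cancel3 (mul_ne_zero h1 (pow_ne_zero 2 h2)) (by linear_combination (-t + t^2) * e0 + (1 - t^2) * e1)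
      (by linear_combination (-t) * e0 + (t + t^2) * e1 + (1 - t^2) * e3)
      (by linear_combination (1) * e0 + (-1 - t) * e1 + (-1 + t^2) * e3)
  · -- (x₁, x₂, x₃) = (t, t, 1): F = (t + 1) * (t - 1) ^ 2
    exact cancel3 (mul_ne_zero h1 (pow_ne_zero 2 h2)) (by linear_combination (-t + t^2) * e0 + (1 - t^2) * e1)
      (by linear_combination (-1 + t^2) * e1 + (1 - t^2) * e3)
      (by linear_combination (1 - t) * e0 + (-1 + t^2) * e3)
  · -- (x₁, x₂, x₃) = (t, t, t): F = (t + 1) * (t - 1) ^ 2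
    exact cancel3 (mul_ne_zero h1 (pow_ne_zero 2 h2)) (by linear_combination (-t + t^2) * e0 + (1 - t^2) * e1)
      (by linear_combination (-t + t^2) * e0 + (1 - t^2) * e3)
      (by linear_combination (1 - t^2) * e0 + (-1 + t^2) * e1 + (-1 + t^2) * e3)

/-- The abstract `3 × 4` system behind three sets with a CYCLIC tournament `A₁ → A₂ → A₃ → A₁`: if
`(1+t)(c₁+c₂+c₃) = 0`, `c₁ + t c₂ + x₁ c₃ = 0`, `x₂ c₁ + c₂ + t c₃ = 0`, `t c₁ + x₃ c₂ + c₃ = 0` with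
`x₁, x₂, x₃ ∈ {0, 1, t}`, `t ≠ ±1` and `t² - t + 1 ≠ 0`, then `c = 0` (all 27 patterns; the primitive sixth roots of
unity are genuinely excluded: for `x = 0` the cycle minor is `1 + t³`). -/
theorem three_rows_cyclic_aux {K : Type*} [Field K] (t c₁ c₂ c₃ x₁ x₂ x₃ : K)
    (h1 : t + 1 ≠ 0) (h2 : t - 1 ≠ 0) (h6 : t ^ 2 - t + 1 ≠ 0)
    (hx₁ : x₁ = 0 ∨ x₁ = 1 ∨ x₁ = t) (hx₂ : x₂ = 0 ∨ x₂ = 1 ∨ x₂ = t) (hx₃ : x₃ = 0 ∨ x₃ = 1 ∨ x₃ = t)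
    (e0 : (1 + t) * c₁ + (1 + t) * c₂ + (1 + t) * c₃ = 0)
    (e1 : c₁ + t * c₂ + x₁ * c₃ = 0) (e2 : x₂ * c₁ + c₂ + t * c₃ = 0) (e3 : t * c₁ + x₃ * c₂ + c₃ = 0) :
    c₁ = 0 ∧ c₂ = 0 ∧ c₃ = 0 := by
  rcases hx₁ with ha | ha | ha <;> rcases hx₂ with hb | hb | hb <;> rcases hx₃ with hc | hc | hc <;>
    rw [ha] at e1 <;> rw [hb] at e2 <;> rw [hc] at e3
  · -- (x₁, x₂, x₃) = (0, 0, 0): F = (t + 1) * (t ^ 2 - t + 1)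
    exact cancel3 (mul_ne_zero h1 h6) (by linear_combination (t^2) * e0 + (1 - t^2) * e1 + (-t - t^2) * e2)
      (by linear_combination (-t) * e0 + (t + t^2) * e1 + (1 + t) * e2)
      (by linear_combination (1) * e0 + (-1 - t) * e1 + (-1 + t^2) * e2)
  · -- (x₁, x₂, x₃) = (0, 0, 1): F = (t + 1) * (t ^ 2 - t + 1)
    exact cancel3 (mul_ne_zero h1 h6) (by linear_combination (t^2) * e0 + (1 - t^2) * e1 + (-t - t^2) * e2)
      (by linear_combination (-t) * e0 + (t + t^2) * e1 + (1 + t) * e2)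
      (by linear_combination (1) * e0 + (-1 - t) * e1 + (-1 + t^2) * e2)
  · -- (x₁, x₂, x₃) = (0, 0, t): F = (t + 1) * (t - 1)
    exact cancel3 (mul_ne_zero h1 h2) (by linear_combination (-1 + t^2) * e0 + (1 - t^2) * e2 + (1 - t^2) * e3)
      (by linear_combination (-t^2) * e0 + (-1 + t^2) * e2 + (t + t^2) * e3)
      (by linear_combination (t) * e0 + (-1 - t) * e3)
  · -- (x₁, x₂, x₃) = (0, 1, 0): F = (t + 1) * (t - 1) ^ 2
    exact cancel3 (mul_ne_zero h1 (pow_ne_zero 2 h2)) (by linear_combination (t^2) * e0 + (1 - t^2) * e1 + (-t - t^2) * e2)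
      (by linear_combination (-t) * e0 + (-1 + t^2) * e1 + (1 + t) * e2)
      (by linear_combination (1 - t) * e0 + (-1 + t^2) * e2)
  · -- (x₁, x₂, x₃) = (0, 1, 1): F = (t + 1) * (t - 1) ^ 2
    exact cancel3 (mul_ne_zero h1 (pow_ne_zero 2 h2)) (by linear_combination (t^2) * e0 + (1 - t^2) * e1 + (-t - t^2) * e2)
      (by linear_combination (-t) * e0 + (-1 + t^2) * e1 + (1 + t) * e2)
      (by linear_combination (1 - t) * e0 + (-1 + t^2) * e2)
  · -- (x₁, x₂, x₃) = (0, 1, t): F = (t + 1) * (t - 1) ^ 2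
    exact cancel3 (mul_ne_zero h1 (pow_ne_zero 2 h2)) (by linear_combination (t^2) * e0 + (1 - t^2) * e1 + (-t - t^2) * e2)
      (by linear_combination (-t) * e0 + (-1 + t^2) * e1 + (1 + t) * e2)
      (by linear_combination (1 - t) * e0 + (-1 + t^2) * e2)
  · -- (x₁, x₂, x₃) = (0, t, 0): F = (t + 1) * (t - 1)
    exact cancel3 (mul_ne_zero h1 h2) (by linear_combination (-t^2) * e0 + (-1 + t^2) * e1 + (t + t^2) * e2)
      (by linear_combination (t) * e0 + (-1 - t) * e2)
      (by linear_combination (-1 + t^2) * e0 + (1 - t^2) * e1 + (1 - t^2) * e2)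
  · -- (x₁, x₂, x₃) = (0, t, 1): F = (t + 1) * (t - 1)
    exact cancel3 (mul_ne_zero h1 h2) (by linear_combination (-t^2) * e0 + (-1 + t^2) * e1 + (t + t^2) * e2)
      (by linear_combination (t) * e0 + (-1 - t) * e2)
      (by linear_combination (-1 + t^2) * e0 + (1 - t^2) * e1 + (1 - t^2) * e2)
  · -- (x₁, x₂, x₃) = (0, t, t): F = (t + 1) * (t - 1)
    exact cancel3 (mul_ne_zero h1 h2) (by linear_combination (-t^2) * e0 + (-1 + t^2) * e1 + (t + t^2) * e2)
      (by linear_combination (t) * e0 + (-1 - t) * e2)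
      (by linear_combination (-1 + t^2) * e0 + (1 - t^2) * e1 + (1 - t^2) * e2)
  · -- (x₁, x₂, x₃) = (1, 0, 0): F = (t + 1) * (t - 1) ^ 2
    exact cancel3 (mul_ne_zero h1 (pow_ne_zero 2 h2)) (by linear_combination (-t) * e0 + (1 + t) * e1 + (-1 + t^2) * e3)
      (by linear_combination (1 - t) * e0 + (-1 + t^2) * e1)
      (by linear_combination (t^2) * e0 + (-t - t^2) * e1 + (1 - t^2) * e3)
  · -- (x₁, x₂, x₃) = (1, 0, 1): F = (t + 1) * (t - 1) ^ 2
    exact cancel3 (mul_ne_zero h1 (pow_ne_zero 2 h2)) (by linear_combination (1 - t) * e0 + (-1 + t^2) * e3)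
      (by linear_combination (1 - t) * e0 + (-1 + t^2) * e1)
      (by linear_combination (-1 + t^2) * e0 + (1 - t^2) * e1 + (1 - t^2) * e3)
  · -- (x₁, x₂, x₃) = (1, 0, t): F = (t + 1) * (t - 1)
    exact cancel3 (mul_ne_zero h1 h2) (by linear_combination (-1 + t^2) * e0 + (1 - t^2) * e2 + (1 - t^2) * e3)
      (by linear_combination (-t^2) * e0 + (-1 + t^2) * e2 + (t + t^2) * e3)
      (by linear_combination (t) * e0 + (-1 - t) * e3)
  · -- (x₁, x₂, x₃) = (1, 1, 0): F = (t + 1) * (t - 1) ^ 2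
    exact cancel3 (mul_ne_zero h1 (pow_ne_zero 2 h2)) (by linear_combination (-1 + t^2) * e0 + (1 - t^2) * e1 + (1 - t^2) * e2)
      (by linear_combination (1 - t) * e0 + (-1 + t^2) * e1)
      (by linear_combination (1 - t) * e0 + (-1 + t^2) * e2)
  · -- (x₁, x₂, x₃) = (1, 1, 1): F = (t + 1) * (t - 1) ^ 2
    exact cancel3 (mul_ne_zero h1 (pow_ne_zero 2 h2)) (by linear_combination (-1 + t^2) * e0 + (1 - t^2) * e1 + (1 - t^2) * e2)
      (by linear_combination (1 - t) * e0 + (-1 + t^2) * e1)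
      (by linear_combination (1 - t) * e0 + (-1 + t^2) * e2)
  · -- (x₁, x₂, x₃) = (1, 1, t): F = (t + 1) * (t - 1) ^ 2
    exact cancel3 (mul_ne_zero h1 (pow_ne_zero 2 h2)) (by linear_combination (-1 + t^2) * e0 + (1 - t^2) * e1 + (1 - t^2) * e2)
      (by linear_combination (1 - t) * e0 + (-1 + t^2) * e1)
      (by linear_combination (1 - t) * e0 + (-1 + t^2) * e2)
  · -- (x₁, x₂, x₃) = (1, t, 0): F = (t + 1) * (t - 1) ^ 2
    exact cancel3 (mul_ne_zero h1 (pow_ne_zero 2 h2)) (by linear_combination (-t) * e0 + (1 + t) * e1 + (-1 + t^2) * e3)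
      (by linear_combination (1 - t) * e0 + (-1 + t^2) * e1)
      (by linear_combination (t^2) * e0 + (-t - t^2) * e1 + (1 - t^2) * e3)
  · -- (x₁, x₂, x₃) = (1, t, 1): F = (t + 1) * (t - 1) ^ 2
    exact cancel3 (mul_ne_zero h1 (pow_ne_zero 2 h2)) (by linear_combination (1 - t) * e0 + (-1 + t^2) * e3)
      (by linear_combination (1 - t) * e0 + (-1 + t^2) * e1)
      (by linear_combination (-1 + t^2) * e0 + (1 - t^2) * e1 + (1 - t^2) * e3)
  · -- (x₁, x₂, x₃) = (1, t, t): F = (t + 1) * (t - 1) ^ 2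
    exact cancel3 (mul_ne_zero h1 (pow_ne_zero 2 h2)) (by linear_combination (1 - t^2) * e1 + (-1 + t^2) * e3)
      (by linear_combination (1 - t) * e0 + (-1 + t^2) * e1)
      (by linear_combination (-t + t^2) * e0 + (1 - t^2) * e3)
  · -- (x₁, x₂, x₃) = (t, 0, 0): F = (t + 1) * (t - 1)
    exact cancel3 (mul_ne_zero h1 h2) (by linear_combination (t) * e0 + (-1 - t) * e1)
      (by linear_combination (-1 + t^2) * e0 + (1 - t^2) * e1 + (1 - t^2) * e3)
      (by linear_combination (-t^2) * e0 + (t + t^2) * e1 + (-1 + t^2) * e3)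
  · -- (x₁, x₂, x₃) = (t, 0, 1): F = (t + 1) * (t - 1) ^ 2
    exact cancel3 (mul_ne_zero h1 (pow_ne_zero 2 h2)) (by linear_combination (-t + t^2) * e0 + (1 - t^2) * e1)
      (by linear_combination (-t) * e0 + (t + t^2) * e1 + (1 - t^2) * e2)
      (by linear_combination (1) * e0 + (-1 - t) * e1 + (-1 + t^2) * e2)
  · -- (x₁, x₂, x₃) = (t, 0, t): F = (t + 1) * (t - 1)
    exact cancel3 (mul_ne_zero h1 h2) (by linear_combination (-1 + t^2) * e0 + (1 - t^2) * e2 + (1 - t^2) * e3)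
      (by linear_combination (-t^2) * e0 + (-1 + t^2) * e2 + (t + t^2) * e3)
      (by linear_combination (t) * e0 + (-1 - t) * e3)
  · -- (x₁, x₂, x₃) = (t, 1, 0): F = (t + 1) * (t - 1)
    exact cancel3 (mul_ne_zero h1 h2) (by linear_combination (t) * e0 + (-1 - t) * e1)
      (by linear_combination (-1 + t^2) * e0 + (1 - t^2) * e1 + (1 - t^2) * e3)
      (by linear_combination (-t^2) * e0 + (t + t^2) * e1 + (-1 + t^2) * e3)
  · -- (x₁, x₂, x₃) = (t, 1, 1): F = (t + 1) * (t - 1) ^ 2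
    exact cancel3 (mul_ne_zero h1 (pow_ne_zero 2 h2)) (by linear_combination (-t + t^2) * e0 + (1 - t^2) * e1)
      (by linear_combination (-1 + t^2) * e1 + (1 - t^2) * e2)
      (by linear_combination (1 - t) * e0 + (-1 + t^2) * e2)
  · -- (x₁, x₂, x₃) = (t, 1, t): F = (t + 1) * (t - 1) ^ 2
    exact cancel3 (mul_ne_zero h1 (pow_ne_zero 2 h2)) (by linear_combination (-t + t^2) * e0 + (1 - t^2) * e1)
      (by linear_combination (-1 + t^2) * e1 + (1 - t^2) * e2)
      (by linear_combination (1 - t) * e0 + (-1 + t^2) * e2)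
  · -- (x₁, x₂, x₃) = (t, t, 0): F = (t + 1) * (t - 1)
    exact cancel3 (mul_ne_zero h1 h2) (by linear_combination (t) * e0 + (-1 - t) * e1)
      (by linear_combination (-1 + t^2) * e0 + (1 - t^2) * e1 + (1 - t^2) * e3)
      (by linear_combination (-t^2) * e0 + (t + t^2) * e1 + (-1 + t^2) * e3)
  · -- (x₁, x₂, x₃) = (t, t, 1): F = (t + 1) * (t - 1) ^ 2
    exact cancel3 (mul_ne_zero h1 (pow_ne_zero 2 h2)) (by linear_combination (-t + t^2) * e0 + (1 - t^2) * e1)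
      (by linear_combination (-t + t^2) * e0 + (1 - t^2) * e2)
      (by linear_combination (1 - t^2) * e0 + (-1 + t^2) * e1 + (-1 + t^2) * e2)
  · -- (x₁, x₂, x₃) = (t, t, t): F = (t + 1) * (t - 1) ^ 2
    exact cancel3 (mul_ne_zero h1 (pow_ne_zero 2 h2)) (by linear_combination (-t + t^2) * e0 + (1 - t^2) * e1)
      (by linear_combination (-t + t^2) * e0 + (1 - t^2) * e2)
      (by linear_combination (1 - t^2) * e0 + (-1 + t^2) * e1 + (-1 + t^2) * e2)


section ThreeSets

variable {α : Type*} [DecidableEq α] {K : Type*} [Field K]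

/-- The pencil entry of a NON-EMPTY column `E` in the row of a set `C` is `0`, `1` or `t`. -/
theorem pencilEntry_trichotomy (E C : Finset α) (hE : E.Nonempty) (t : K) :
    ((if E ⊆ C then (1 : K) else 0) + t * (if Disjoint E C then (1 : K) else 0) = 0) ∨
    ((if E ⊆ C then (1 : K) else 0) + t * (if Disjoint E C then (1 : K) else 0) = 1) ∨
    ((if E ⊆ C then (1 : K) else 0) + t * (if Disjoint E C then (1 : K) else 0) = t) := by
  by_cases h1 : E ⊆ C
  · by_cases h2 : Disjoint E C
    · exfalso
      obtain ⟨x, hx⟩ := hE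
      exact (disjoint_left.mp h2) hx (h1 hx)
    · right; left; simp [h1, h2]
  · by_cases h2 : Disjoint E C
    · right; right; simp [h1, h2]
    · left; simp [h1, h2]

/-- The pencil entry of the column `A \ B` (`A ⊄ B`) in the row of `A` is `1`. -/
theorem pencilEntry_sdiff_left (A B : Finset α) (h : ¬ A ⊆ B) (t : K) :
    (if A \ B ⊆ A then (1 : K) else 0) + t * (if Disjoint (A \ B) A then (1 : K) else 0) = 1 := by
  obtain ⟨x, hxA, hxB⟩ := not_subset.mp h
  have hnd : ¬ Disjoint (A \ B) A := fun hd => (disjoint_left.mp hd) (mem_sdiff.mpr ⟨hxA, hxB⟩) hxA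
  simp [sdiff_subset, hnd]

/-- The pencil entry of the column `A \ B` (`A ⊄ B`) in the row of `B` is `t`. -/
theorem pencilEntry_sdiff_right (A B : Finset α) (h : ¬ A ⊆ B) (t : K) :
    (if A \ B ⊆ B then (1 : K) else 0) + t * (if Disjoint (A \ B) B then (1 : K) else 0) = t := by
  obtain ⟨x, hxA, hxB⟩ := not_subset.mp h
  have hns : ¬ A \ B ⊆ B := fun hs => hxB (hs (mem_sdiff.mpr ⟨hxA, hxB⟩))
  simp [hns, disjoint_sdiff_self_left]

/-- **CONJECTURE ORD holds for three sets, over every field.**  Let `A₁ ⊄ A₂`, `A₁ ⊄ A₃`, `A₂ ⊄ A₃` (an admissible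
order of three — necessarily distinct — finite sets) and let `t + 1 ≠ 0`, `t - 1 ≠ 0`.  If `c₁, c₂, c₃` is a dependency
of the three pencil rows `E ↦ [E ⊆ Aᵢ] + t [E ∩ Aᵢ = ∅]` on the ordered half `{∅, A₁ \ A₂, A₁ \ A₃, A₂ \ A₃}`, then
`c₁ = c₂ = c₃ = 0`. -/
theorem dep_eq_zero_three_sets_ordered (A₁ A₂ A₃ : Finset α) (h12 : ¬ A₁ ⊆ A₂) (h13 : ¬ A₁ ⊆ A₃)
    (h23 : ¬ A₂ ⊆ A₃) (t : K) (ht1 : t + 1 ≠ 0) (ht2 : t - 1 ≠ 0) (c₁ c₂ c₃ : K)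
    (hdep : ∀ E ∈ ({∅, A₁ \ A₂, A₁ \ A₃, A₂ \ A₃} : Finset (Finset α)),
      c₁ * ((if E ⊆ A₁ then (1 : K) else 0) + t * (if Disjoint E A₁ then (1 : K) else 0)) +
      c₂ * ((if E ⊆ A₂ then (1 : K) else 0) + t * (if Disjoint E A₂ then (1 : K) else 0)) +
      c₃ * ((if E ⊆ A₃ then (1 : K) else 0) + t * (if Disjoint E A₃ then (1 : K) else 0)) = 0) :
    c₁ = 0 ∧ c₂ = 0 ∧ c₃ = 0 := by
  have n12 : (A₁ \ A₂).Nonempty := by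
    obtain ⟨x, hx, hx'⟩ := not_subset.mp h12; exact ⟨x, mem_sdiff.mpr ⟨hx, hx'⟩⟩
  have n13 : (A₁ \ A₃).Nonempty := by
    obtain ⟨x, hx, hx'⟩ := not_subset.mp h13; exact ⟨x, mem_sdiff.mpr ⟨hx, hx'⟩⟩
  have n23 : (A₂ \ A₃).Nonempty := by
    obtain ⟨x, hx, hx'⟩ := not_subset.mp h23; exact ⟨x, mem_sdiff.mpr ⟨hx, hx'⟩⟩
  set x₁ := (if A₁ \ A₂ ⊆ A₃ then (1 : K) else 0) + t * (if Disjoint (A₁ \ A₂) A₃ then (1 : K) else 0) with hx₁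
  set x₂ := (if A₁ \ A₃ ⊆ A₂ then (1 : K) else 0) + t * (if Disjoint (A₁ \ A₃) A₂ then (1 : K) else 0) with hx₂
  set x₃ := (if A₂ \ A₃ ⊆ A₁ then (1 : K) else 0) + t * (if Disjoint (A₂ \ A₃) A₁ then (1 : K) else 0) with hx₃
  have f0 := hdep ∅ (by simp)
  have f1 := hdep (A₁ \ A₂) (by simp)
  have f2 := hdep (A₁ \ A₃) (by simp)
  have f3 := hdep (A₂ \ A₃) (by simp)
  simp only [empty_subset, if_true, disjoint_empty_left] at f0
  rw [pencilEntry_sdiff_left A₁ A₂ h12 t, pencilEntry_sdiff_right A₁ A₂ h12 t, ← hx₁] at f1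
  rw [pencilEntry_sdiff_left A₁ A₃ h13 t, pencilEntry_sdiff_right A₁ A₃ h13 t, ← hx₂] at f2
  rw [pencilEntry_sdiff_left A₂ A₃ h23 t, pencilEntry_sdiff_right A₂ A₃ h23 t, ← hx₃] at f3
  have e0 : (1 + t) * c₁ + (1 + t) * c₂ + (1 + t) * c₃ = 0 := by linear_combination f0
  have e1 : c₁ + t * c₂ + x₁ * c₃ = 0 := by linear_combination f1
  have e2 : c₁ + x₂ * c₂ + t * c₃ = 0 := by linear_combination f2
  have e3 : x₃ * c₁ + c₂ + t * c₃ = 0 := by linear_combination f3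
  exact three_rows_transitive_aux t c₁ c₂ c₃ x₁ x₂ x₃ ht1 ht2
    (pencilEntry_trichotomy _ _ n12 t) (pencilEntry_trichotomy _ _ n13 t) (pencilEntry_trichotomy _ _ n23 t)
    e0 e1 e2 e3

/-- **The cyclic tournament on three sets.**  Let `A₁ ⊄ A₂`, `A₂ ⊄ A₃`, `A₃ ⊄ A₁` and let `t + 1 ≠ 0`, `t - 1 ≠ 0`,
`t² - t + 1 ≠ 0`.  If `c₁, c₂, c₃` is a dependency of the three pencil rows on the cyclic tournament columns
`{∅, A₁ \ A₂, A₂ \ A₃, A₃ \ A₁}`, then `c₁ = c₂ = c₃ = 0`.  (The condition `t² - t + 1 ≠ 0` cannot be dropped: for three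
sets in general position the rows are dependent at the primitive sixth roots of unity.) -/
theorem dep_eq_zero_three_sets_cyclic (A₁ A₂ A₃ : Finset α) (h12 : ¬ A₁ ⊆ A₂) (h23 : ¬ A₂ ⊆ A₃)
    (h31 : ¬ A₃ ⊆ A₁) (t : K) (ht1 : t + 1 ≠ 0) (ht2 : t - 1 ≠ 0) (ht6 : t ^ 2 - t + 1 ≠ 0) (c₁ c₂ c₃ : K)
    (hdep : ∀ E ∈ ({∅, A₁ \ A₂, A₂ \ A₃, A₃ \ A₁} : Finset (Finset α)),
      c₁ * ((if E ⊆ A₁ then (1 : K) else 0) + t * (if Disjoint E A₁ then (1 : K) else 0)) +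
      c₂ * ((if E ⊆ A₂ then (1 : K) else 0) + t * (if Disjoint E A₂ then (1 : K) else 0)) +
      c₃ * ((if E ⊆ A₃ then (1 : K) else 0) + t * (if Disjoint E A₃ then (1 : K) else 0)) = 0) :
    c₁ = 0 ∧ c₂ = 0 ∧ c₃ = 0 := by
  have n12 : (A₁ \ A₂).Nonempty := by
    obtain ⟨x, hx, hx'⟩ := not_subset.mp h12; exact ⟨x, mem_sdiff.mpr ⟨hx, hx'⟩⟩
  have n23 : (A₂ \ A₃).Nonempty := by
    obtain ⟨x, hx, hx'⟩ := not_subset.mp h23; exact ⟨x, mem_sdiff.mpr ⟨hx, hx'⟩⟩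
  have n31 : (A₃ \ A₁).Nonempty := by
    obtain ⟨x, hx, hx'⟩ := not_subset.mp h31; exact ⟨x, mem_sdiff.mpr ⟨hx, hx'⟩⟩
  set x₁ := (if A₁ \ A₂ ⊆ A₃ then (1 : K) else 0) + t * (if Disjoint (A₁ \ A₂) A₃ then (1 : K) else 0) with hx₁
  set x₂ := (if A₂ \ A₃ ⊆ A₁ then (1 : K) else 0) + t * (if Disjoint (A₂ \ A₃) A₁ then (1 : K) else 0) with hx₂
  set x₃ := (if A₃ \ A₁ ⊆ A₂ then (1 : K) else 0) + t * (if Disjoint (A₃ \ A₁) A₂ then (1 : K) else 0) with hx₃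
  have f0 := hdep ∅ (by simp)
  have f1 := hdep (A₁ \ A₂) (by simp)
  have f2 := hdep (A₂ \ A₃) (by simp)
  have f3 := hdep (A₃ \ A₁) (by simp)
  simp only [empty_subset, if_true, disjoint_empty_left] at f0
  rw [pencilEntry_sdiff_left A₁ A₂ h12 t, pencilEntry_sdiff_right A₁ A₂ h12 t, ← hx₁] at f1
  rw [pencilEntry_sdiff_left A₂ A₃ h23 t, pencilEntry_sdiff_right A₂ A₃ h23 t, ← hx₂] at f2
  rw [pencilEntry_sdiff_left A₃ A₁ h31 t, pencilEntry_sdiff_right A₃ A₁ h31 t, ← hx₃] at f3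
  have e0 : (1 + t) * c₁ + (1 + t) * c₂ + (1 + t) * c₃ = 0 := by linear_combination f0
  have e1 : c₁ + t * c₂ + x₁ * c₃ = 0 := by linear_combination f1
  have e2 : x₂ * c₁ + c₂ + t * c₃ = 0 := by linear_combination f2
  have e3 : t * c₁ + x₃ * c₂ + c₃ = 0 := by linear_combination f3
  exact three_rows_cyclic_aux t c₁ c₂ c₃ x₁ x₂ x₃ ht1 ht2 ht6
    (pencilEntry_trichotomy _ _ n12 t) (pencilEntry_trichotomy _ _ n23 t) (pencilEntry_trichotomy _ _ n31 t)
    e0 e1 e2 e3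

end ThreeSets

end OrderedDifferences

end Summit.CriticalPhenomena.PercolationContinuityZ3.Theorems
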